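import Summits.Ventures.HSemireg.HomComplexSigma
import Summits.Ventures.HSemireg.DerivedDescentBaseChange
import Mathlib.Algebra.Homology.DerivedCategory.ExactFunctor
import HarnessLib

/-!
# Road №4 (`VHCAbelianSchemesRoad`) — plumbing for core (SC) of THEOREM T (crux stmt-HodgeConjecture-26512): the ABSTRACT TRANSFER of
# Buchweitz–Flenner `I`-semiregularity along a `σ`-compatible pair of actions, and DERIVED LIFTING DATA (an endofunctor of derived
# categories computing a termwise functor on a class of complexes) with their action `G_{**}` on shifted Homs

research route conditional on HC_CM; not a corollary; Q11.4-sentence-2 already refuted in dim ≥ 3.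

core-SC gen 0 (director-hodge g14 R14.24, plate (SC); LEAD 163 BOOKED l.5521). `--supports stmt-HodgeConjecture-26512 --as helper`; closes
NO stub or item; generic kernel plumbing (nothing about any variety); nothing here says (SC), THEOREM T, `HC_AV`, `HC_CM` or HC holds;
HC_CM HELD. Consumed by `VHCAbelianSchemesRoadIsogenyPushforwardISemiregularCTransfer.lean` (the composition of core (SC)).

WHY. The venture transports `σ_q` (`HomComplex.sigmaC`) and `IsISemiregularC` along ISOMORPHISMS of schemes through ONE vehicle,
`e_{**} = Summit.Ventures.HSemireg.mapShiftedHom (pushforward e.hom.left)` — the action on shifted Homs of Mathlib's `mapDerivedCategory` of an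
EXACT functor (`DerivedDescentBaseChange.lean`). For an isogeny `g` of degree `≥ 2` the direct image `Scheme.Modules.pushforward g` is NOT
right exact on `Mod 𝒪_A` (see the companion file), so the vehicle must be replaced by a functor of derived categories that is only KNOWN
to compute `g_*•` on a class of complexes (model: `Rg_*` on bounded complexes of `g_*`-acyclic modules). This file supplies the two
generic pieces:

* §1 **ABSTRACT TRANSFER** (unconditional, any two `S`-schemes, any derived-category instances): for `Ψ : Ext²(K,K) → Ext²(K',K')` and maps
  `ρ_q` between the `σ`-targets `Hom_D(Q 𝒪[0], (Q Ω^q[0])⟦q+2⟧)` (`sigmaTarget`) with `σ_q^{K'}(Ψ x) = ρ_q(σ_q^K x)` for `q ∈ J`: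
  `Ψ` surjective ∧ `ρ_q` injective ⟹ (`IsISemiregularC K J → IsISemiregularC K' J`) (`isISemiregularC_of_sigmaCompat_of_surjective`);
  `Ψ` injective ⟹ the converse (`…_of_injective`); hence `↔` (`isISemiregularC_iff_of_sigmaCompat`). This is the logical skeleton of
  §3 of `HomComplexSigmaOfSchemeIso` (there `Ψ = e_{**}` bijective, `ρ_q` = conjugation by isomorphisms). Also the TAIL of `σ_q`,
  `sigmaTail(y) = Q(unit) · Φ_K(y) · Q(Tr•^H)`, with `σ_q(x) = sigmaTail(x · ι• · At(K)^q)` DEFINITIONALLY (`sigmaC_eq_sigmaTail`).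
* §2 **`DerivedLiftingDatum G P`** (structure, data): an additive shift-commuting functor `R : D(C₁) ⥤ D(C₂)` with isomorphisms
  `R (Q K) ≅ Q (G K)` for the complexes `K` satisfying `P`, natural in chain maps between them; **`DerivedLiftingDatum.mapShiftedHom`**
  (`G_{**}`: `y ↦ iso⁻¹ ≫ R(y)♮ ≫ iso⟦n⟧'`, the venture's sandwich); `G_{**}` is MULTIPLICATIVE for `ShiftedHom.comp` (`mapShiftedHom_comp`),
  sends `[Q f]` to `[Q (G f)]` (`mapShiftedHom_mk₀`), is additive (`mapShiftedHom_add`); an EXACT functor carries the datum on all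
  complexes (`ofExact`: Mathlib's `mapDerivedCategory` ∕ `mapDerivedCategoryFactors`) with `G_{**}` = the venture's `mapShiftedHom`
  DEFINITIONALLY (`mapShiftedHom_ofExact`).

References: [cite: BuchweitzFlenner2003, Def. 4.1 and §5 (I-semiregular)] [cite: Weibel1994, §10.4, Cor. 10.4.7 and §10.5 (total derived
functors)] [cite: Hartshorne1977, III.1 (derived functors) and III.8 (higher direct images)]; Mathlib `CategoryTheory.Shift.ShiftedHom`,
`Algebra.Homology.DerivedCategory.ExactFunctor`. Generic bookkeeping (no printed statement is typed verbatim).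
-/

noncomputable section

-- `TopCat.Presheaf`/`Scheme.Modules` are not reducible (as in Mathlib's `AlgebraicGeometry/Modules/Sheaf.lean`).
set_option backward.isDefEq.respectTransparency false

open CategoryTheory CategoryTheory.Category CategoryTheory.Limits AlgebraicGeometry Opposite
open DerivedCategory

namespace Summit.HodgeConjecture.HodgeConjecture.Ring2.SemiregularRepresentatives

set_option linter.dupNamespace false -- the cell's namespace repeats the summit name, as in every `Ring2*` file

open Literature.AlgebraicGeometry.Modules Literature.AlgebraicGeometry.Motives
open Summit.Ventures.HSemireg Summit.Ventures.HSemireg.HomComplex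

/-! ## §1 The abstract transfer of Buchweitz–Flenner `I`-semiregularity along a `σ`-compatible pair of actions -/

section AbstractTransfer

universe w₀ w₁ u

variable {S : Type u} [CommRing S] {X₀ X₁ : Over (Spec (CommRingCat.of S))}
  [HasDerivedCategory.{w₀} X₀.left.Modules] [HasDerivedCategory.{w₁} X₁.left.Modules]

/-- The target of `σ_q`: `Hom_{D(X)}(Q 𝒪_X[0], (Q Ω^q_X[0])⟦q+2⟧)` (the codomain of `HomComplex.sigmaC`, definitionally).
[cite: BuchweitzFlenner2003, Def. 4.1] -/
abbrev sigmaTarget (X : Over (Spec (CommRingCat.of S))) [HasDerivedCategory X.left.Modules] (q : ℕ) : Type _ :=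
  ShiftedHom (Q.obj ((HomologicalComplex.single X.left.Modules (ComplexShape.up ℤ) 0).obj (unitModule X.left)))
    (Q.obj ((HomologicalComplex.single X.left.Modules (ComplexShape.up ℤ) 0).obj (hodgeSheaf X q))) ((q + 2 : ℕ) : ℤ)

/-- **The tail of `σ_q`**: `y ↦ Q(unit) · Φ_K(y) · Q(Tr•^H)` for `y : Q K ⟶ (Q (K ⊗ Ω^q))⟦q+2⟧`, so that
`σ_q(x) = sigmaTail (x · ι• · At(K)^q)` DEFINITIONALLY (`sigmaC_eq_sigmaTail`); it is the part of `σ_q` made of the unit, the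
descended internal Hom `Φ_K = shiftedHomMap 𝓗om•(K, –)` and the supertrace — the part on which the trace-side compatibility
`TracePushforwardCompat` is stated. [cite: BuchweitzFlenner2003, Def. 4.1 (σ = Tr(– · At^q))] -/
def sigmaTail (X : Over (Spec (CommRingCat.of S))) [HasDerivedCategory X.left.Modules] (K : CochainComplex X.left.Modules ℤ)
    (a b : ℤ) [K.IsStrictlyGE a] [K.IsStrictlyLE b] (hK : ∀ p, IsFiniteLocallyFree (K.X p)) (q : ℕ)
    (y : ShiftedHom (Q.obj K) (Q.obj (twistHodgeComplex X q K)) ((q : ℤ) + 2)) : sigmaTarget X q :=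
  ((ShiftedHom.mk₀ (0 : ℤ) rfl (unitQ X K a b)).comp
      (shiftedHomMap (homFunctor X.left K) (homFunctor_isInvertedBy X K a b hK) y) (add_zero _)).comp
    (ShiftedHom.mk₀ (0 : ℤ) rfl (Q.map (supertraceH X K hK q))) (by omega)

/-- `σ_q(x) = sigmaTail (x · ι• · At(K)^q)` (definitional unfolding of `HomComplex.sigmaC` ∕ `phiMulAtiyahPower`).
[cite: BuchweitzFlenner2003, Def. 4.1] -/
theorem sigmaC_eq_sigmaTail (X : Over (Spec (CommRingCat.of S))) [HasDerivedCategory X.left.Modules]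
    (K : CochainComplex X.left.Modules ℤ) (a b : ℤ) [K.IsStrictlyGE a] [K.IsStrictlyLE b]
    (hK : ∀ p, IsFiniteLocallyFree (K.X p)) (q : ℕ) (x : ShiftedHom (Q.obj K) (Q.obj K) (2 : ℤ)) :
    sigmaC X K a b hK q x = sigmaTail X K a b hK q (extMulAtiyahPower X K q x) :=
  rfl

variable {K : CochainComplex X₀.left.Modules ℤ} {a b : ℤ} [K.IsStrictlyGE a] [K.IsStrictlyLE b]
  {hK : ∀ p, IsFiniteLocallyFree (K.X p)}
  {K' : CochainComplex X₁.left.Modules ℤ} {a' b' : ℤ} [K'.IsStrictlyGE a'] [K'.IsStrictlyLE b']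
  {hK' : ∀ p, IsFiniteLocallyFree (K'.X p)}
  (Ψ : ShiftedHom (Q.obj K) (Q.obj K) (2 : ℤ) → ShiftedHom (Q.obj K') (Q.obj K') (2 : ℤ))
  (ρ : ∀ q : ℕ, sigmaTarget X₀ q → sigmaTarget X₁ q) {J : Set ℕ}
  (hσ : ∀ q ∈ J, ∀ x, sigmaC X₁ K' a' b' hK' q (Ψ x) = ρ q (sigmaC X₀ K a b hK q x))

include hσ

/-- **Abstract transfer of `I`-semiregularity, forward**: if `Ψ : Ext²(K,K) → Ext²(K',K')` and `ρ_q` on the `σ`-targets satisfy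
`σ_q^{K'}(Ψ x) = ρ_q(σ_q^K x)` for `q ∈ J`, `Ψ` is SURJECTIVE and every `ρ_q` (`q ∈ J`) is INJECTIVE, then joint injectivity of
`(σ_q^K)_{q ∈ J}` implies joint injectivity of `(σ_q^{K'})_{q ∈ J}`. The logical skeleton of every THEOREM-T-type transfer (for an
isomorphism of schemes: `Ψ = e_{**}` bijective, `ρ_q` = conjugation by isomorphisms, `HomComplexSigmaOfSchemeIso` §3).
[cite: BuchweitzFlenner2003, Def. 4.1 and §5 (I-semiregular)] -/
theorem isISemiregularC_of_sigmaCompat_of_surjective (hΨ : Function.Surjective Ψ)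
    (hρ : ∀ q ∈ J, Function.Injective (ρ q)) (h : IsISemiregularC X₀ K a b hK J) :
    IsISemiregularC X₁ K' a' b' hK' J := by
  intro x' y' hxy
  obtain ⟨x, rfl⟩ := hΨ x'
  obtain ⟨y, rfl⟩ := hΨ y'
  have hxy' : x = y := h (funext fun q => by
    have hq := congr_fun hxy q
    dsimp only at hq ⊢
    rw [hσ q.1 q.2, hσ q.1 q.2] at hq
    exact hρ q.1 q.2 hq)
  rw [hxy']

/-- **Abstract transfer of `I`-semiregularity, backward**: if `σ_q^{K'}(Ψ x) = ρ_q(σ_q^K x)` for `q ∈ J` and `Ψ` is INJECTIVE, then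
joint injectivity of `(σ_q^{K'})_{q ∈ J}` implies joint injectivity of `(σ_q^K)_{q ∈ J}` (no hypothesis on `ρ`).
[cite: BuchweitzFlenner2003, Def. 4.1 and §5 (I-semiregular)] -/
theorem isISemiregularC_of_sigmaCompat_of_injective (hΨ : Function.Injective Ψ)
    (h : IsISemiregularC X₁ K' a' b' hK' J) : IsISemiregularC X₀ K a b hK J := by
  intro x y hxy
  apply hΨ
  refine h (funext fun q => ?_)
  have hq := congrArg (ρ q.1) (congr_fun hxy q)
  dsimp only at hq ⊢
  rw [← hσ q.1 q.2, ← hσ q.1 q.2] at hq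
  exact hq

/-- **The two-sided form**: `Ψ` bijective and `ρ_q` injective (`q ∈ J`) give
`IsISemiregularC K' J ↔ IsISemiregularC K J`. [cite: BuchweitzFlenner2003, §5 (I-semiregular)] -/
theorem isISemiregularC_iff_of_sigmaCompat (hΨ : Function.Bijective Ψ) (hρ : ∀ q ∈ J, Function.Injective (ρ q)) :
    IsISemiregularC X₁ K' a' b' hK' J ↔ IsISemiregularC X₀ K a b hK J :=
  ⟨isISemiregularC_of_sigmaCompat_of_injective Ψ ρ hσ hΨ.1,
    isISemiregularC_of_sigmaCompat_of_surjective Ψ ρ hσ hΨ.2 hρ⟩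

end AbstractTransfer

/-! ## §2 Derived lifting data: an endofunctor of derived categories that computes a termwise functor `G` on a class `P` of
complexes, and its action `G_{**}` on shifted Homs (the vehicle replacing `mapDerivedCategory` of an exact functor) -/

section Datum

universe w₁ w₂ v₁ v₂ u₁ u₂

variable {C₁ : Type u₁} [Category.{v₁} C₁] [Abelian C₁] [HasDerivedCategory.{w₁} C₁]
  {C₂ : Type u₂} [Category.{v₂} C₂] [Abelian C₂] [HasDerivedCategory.{w₂} C₂]

/-- **A derived lifting datum for a functor `G` of cochain complexes on an object property `P`**: an additive,
shift-commuting functor `R : D(C₁) ⥤ D(C₂)` together with isomorphisms `R (Q K) ≅ Q (G K)` for the complexes `K` satisfying `P`,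
natural in chain maps between such complexes. MODEL: `G = g_*•` the termwise direct image along a morphism of schemes `g`,
`P` = bounded complexes of `g_*`-acyclic (e.g. quasi-coherent, `g` affine) modules, `R = Rg_*` the right-derived direct image on
the unbounded derived category, the isomorphisms = «a bounded complex of acyclic objects computes the derived functor». For an
EXACT functor `F`, Mathlib's `F.mapDerivedCategory` with `F.mapDerivedCategoryFactors` is such a datum on ALL complexes
(`DerivedLiftingDatum.ofExact`). A STRUCTURE (data), not a proposition: the tree cannot yet construct `Rg_*`
(Mathlib's `Functor.rightDerivedFunctorPlus` lives on `DerivedCategory.Plus` and needs `EnoughInjectives`).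
[cite: Hartshorne1977, III.1 (derived functors) and III.8 (higher direct images)] [cite: Weibel1994, §10.4, Cor. 10.4.7 and §10.5 (total derived functors)] -/
structure DerivedLiftingDatum (G : CochainComplex C₁ ℤ ⥤ CochainComplex C₂ ℤ) (P : CochainComplex C₁ ℤ → Prop) where
  /-- The functor of derived categories (model: `Rg_*`). -/
  functor : DerivedCategory C₁ ⥤ DerivedCategory C₂
  /-- It is additive. -/
  additive : functor.Additive
  /-- It commutes with the shifts. -/
  commShift : functor.CommShift ℤ
  /-- On a complex satisfying `P` it is computed by `G` (model: `Rg_*(K•) ≅ g_*•K•` for `K•` bounded with acyclic terms). -/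
  iso : ∀ K : CochainComplex C₁ ℤ, P K → (functor.obj (Q.obj K) ≅ Q.obj (G.obj K))
  /-- The comparison isomorphisms are natural in chain maps between complexes satisfying `P`. -/
  iso_hom_naturality : ∀ {K L : CochainComplex C₁ ℤ} (hK : P K) (hL : P L) (f : K ⟶ L),
    functor.map (Q.map f) ≫ (iso L hL).hom = (iso K hK).hom ≫ Q.map (G.map f)

namespace DerivedLiftingDatum

variable {G : CochainComplex C₁ ℤ ⥤ CochainComplex C₂ ℤ} {P : CochainComplex C₁ ℤ → Prop} (R : DerivedLiftingDatum G P)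

/-- **`G_{**}` — the action of a derived lifting datum on shifted Homs of `P`-complexes**:
`y : Q K ⟶ (Q L)⟦n⟧ ↦ iso_K⁻¹ ≫ R(y)♮ ≫ iso_L⟦n⟧' : Q (G K) ⟶ (Q (G L))⟦n⟧` (`R(y)♮ = y.map R` absorbs the commutation of `R`
with the shift) — the same sandwich as the venture's `mapShiftedHom` for an exact functor (`mapShiftedHom_ofExact`). Model: `Rg_*` on
`Ext^n(K•, L•)` followed by the identifications `Rg_*K• = g_*•K•`. [cite: Weibel1994, §10.4 and Cor. 10.4.7] -/
def mapShiftedHom {K L : CochainComplex C₁ ℤ} (hK : P K) (hL : P L) {n : ℤ} (y : ShiftedHom (Q.obj K) (Q.obj L) n) :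
    ShiftedHom (Q.obj (G.obj K)) (Q.obj (G.obj L)) n :=
  letI := R.commShift
  (R.iso K hK).inv ≫ y.map R.functor ≫ ((R.iso L hL).hom)⟦n⟧'

/-- **`G_{**}(x · y) = G_{**}(x) · G_{**}(y)`** for Mathlib's `ShiftedHom.comp` (the middle comparison isomorphisms cancel;
`ShiftedHom.map_comp`). [cite: Weibel1994, §10.4 and Cor. 10.4.7] -/
theorem mapShiftedHom_comp {K L M : CochainComplex C₁ ℤ} (hK : P K) (hL : P L) (hM : P M) {a b c : ℤ}
    (x : ShiftedHom (Q.obj K) (Q.obj L) a) (y : ShiftedHom (Q.obj L) (Q.obj M) b) (h : b + a = c) :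
    R.mapShiftedHom hK hM (x.comp y h) = (R.mapShiftedHom hK hL x).comp (R.mapShiftedHom hL hM y) h := by
  letI := R.commShift
  unfold mapShiftedHom
  rw [ShiftedHom.map_comp]
  simp only [ShiftedHom.comp, Functor.map_comp, Category.assoc]
  rw [← (shiftFunctor (DerivedCategory C₂) a).map_comp_assoc (R.iso L hL).hom (R.iso L hL).inv, Iso.hom_inv_id,
    CategoryTheory.Functor.map_id, Category.id_comp]
  erw [← (shiftFunctorAdd' (DerivedCategory C₂) b a c h).inv.naturality (R.iso M hM).hom]
  rfl

/-- `G_{**}` on a degree-`0` class `[Q f]` of a chain map `f` between `P`-complexes: `G_{**}([Q f]) = [Q (G f)]` (naturality of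
the comparison isomorphisms). [folklore] -/
theorem mapShiftedHom_mk₀ {K L : CochainComplex C₁ ℤ} (hK : P K) (hL : P L) (f : K ⟶ L) :
    R.mapShiftedHom hK hL (ShiftedHom.mk₀ (0 : ℤ) rfl (Q.map f)) = ShiftedHom.mk₀ (0 : ℤ) rfl (Q.map (G.map f)) := by
  letI := R.commShift
  have hnat : (R.iso K hK).inv ≫ R.functor.map (Q.map f) = Q.map (G.map f) ≫ (R.iso L hL).inv := by
    rw [Iso.inv_comp_eq, ← Category.assoc, Iso.eq_comp_inv]
    exact R.iso_hom_naturality hK hL f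
  unfold mapShiftedHom
  rw [ShiftedHom.map_mk₀]
  simp only [ShiftedHom.mk₀, Category.assoc]
  rw [reassoc_of% hnat]
  congr 1
  erw [← (shiftFunctorZero' (DerivedCategory C₂) (0 : ℤ) rfl).inv.naturality (R.iso L hL).hom]
  erw [Iso.inv_hom_id_assoc]

/-- `G_{**}` is additive. [folklore] -/
theorem mapShiftedHom_add {K L : CochainComplex C₁ ℤ} (hK : P K) (hL : P L) {n : ℤ}
    (x y : ShiftedHom (Q.obj K) (Q.obj L) n) :
    R.mapShiftedHom hK hL (x + y) = R.mapShiftedHom hK hL x + R.mapShiftedHom hK hL y := by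
  letI := R.commShift
  letI := R.additive
  simp only [mapShiftedHom, ShiftedHom.map_add, Preadditive.add_comp, Preadditive.comp_add]

/-- **Exact functors carry a derived lifting datum on all complexes**: `R = F.mapDerivedCategory`, comparison
`F.mapDerivedCategoryFactors` (Mathlib). [cite: Weibel1994, §10.4 and Cor. 10.4.7] -/
def ofExact (F : C₁ ⥤ C₂) [F.Additive] [PreservesFiniteLimits F] [PreservesFiniteColimits F] :
    DerivedLiftingDatum (F.mapHomologicalComplex (ComplexShape.up ℤ)) (fun _ => True) where
  functor := F.mapDerivedCategory
  additive := inferInstance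
  commShift := inferInstance
  iso K _ := F.mapDerivedCategoryFactors.app K
  iso_hom_naturality _ _ f := F.mapDerivedCategoryFactors.hom.naturality f

/-- For an exact functor the datum's action IS the venture's `mapShiftedHom` (definitionally). [folklore] -/
theorem mapShiftedHom_ofExact (F : C₁ ⥤ C₂) [F.Additive] [PreservesFiniteLimits F] [PreservesFiniteColimits F]
    {K L : CochainComplex C₁ ℤ} {n : ℤ} (y : ShiftedHom (Q.obj K) (Q.obj L) n) :
    (ofExact F).mapShiftedHom trivial trivial y = Summit.Ventures.HSemireg.mapShiftedHom F y :=
  rfl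

end DerivedLiftingDatum

end Datum

end Summit.HodgeConjecture.HodgeConjecture.Ring2.SemiregularRepresentatives

end
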